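import Summits.CriticalPhenomena.SAWScalingLimit.Theses.SAWCircleScreening

/-!
# Birth skeleton (`Lines/birth.lean`) for crux `ScreenOverlap` (stmt-CriticalPhenomena-5463)

Route `SAWCircleScreening` of `CriticalPhenomena/SAWScalingLimit`, crux r3 `ScreenOverlap` (S2 of the card
`circle-bridge-screening`, "CrossingHarnack, integrated"): a universal `c₁ > 0` such that for every Jordan
domain flat (half-disc through `c`, or full disc) inside `B(c,4ρ)`, two near data `(K,a)`, `(K',a')` inside
`B̄(c,ρ)` (`2δ ≤ ρ`) and a common target `b` beyond `4ρ`, the laws of the CANONICAL SCREEN DATUM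
`p = (j, x, y)` — least grid radius `r_j = 2ρ + jδ ≤ 3ρ` crossed exactly once, and its exit edge `(x,y)` —
under the two critical SAW laws `P_{K,a} = SAW.law (Ω ∖ K)_δ a b`, `P_{K',a'}` overlap:
`Σ'_p min(P_{K,a}(E_p), P_{K',a'}(E_p)) ≥ c₁`.

## The line (the route header's TWO-LAYER PLAN for S2, typed: `ScreenOverlap ⇐ ExitHarnack (pointwise
comparability of exit-edge laws) → canonical-screen bookkeeping → ScreenOverlap`; the bookkeeping is PROVED
here, and the declared dependency `[deps: CircleBridgeAbundance]` is the second stub)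

Vocabulary (§1) is the crux's set-builder terms VERBATIM: `screenEvent Ω δ a b c ρ p` (the event `E_p` of the
crux), `singleCrossing Ω δ a b c ρ` (the event of the sibling crux `CircleBridgeAbundance`: SOME grid circle of
radius in `[2ρ,3ρ]` is crossed exactly once) and `screenOverlapMass` (the crux's right-hand `∑'`);
`screenOverlap_iff : ScreenOverlap' ↔ ScreenOverlap := Iff.rfl` and `screenAbundance_iff : ScreenAbundance ↔
CircleBridgeAbundance := Iff.rfl` certify the transcription.  Two stubs:

* `stub_exitHarnack : ExitHarnack` (XL, HARDEST, load-bearing) — POINTWISE one-sided comparability of the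
  canonical-screen-datum laws across near data: a universal `c₂ > 0` with
  `c₂ · P_{K',a'}(E_p) ≤ P_{K,a}(E_p)` for EVERY datum `p`, under exactly the crux's hypotheses (the
  hypotheses are symmetric in `(K,a) ↔ (K',a')`, so this is two-sided comparability).  By the EXACT SCREEN
  factorisation `Z_{K,a}(E_p) = Z^{in}_{K,a}(j,x) · x_c · Z^{out}_b(j,y)` (prefix inside the open ball
  `B(c,r_j)`, suffix outside: vertex-disjoint by the radius, so concatenation is free and the suffix factor
  does not see the near data) the claim is a boundary-Harnack / separation statement for the INNER partition
  functions `Z^{in}_{K,a}(j,x)` of `x_c`-weighted self-avoiding prefixes from `a` to the exit vertex `x`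
  inside `B(c,3ρ)`, relative to the total mass — the SAW analogue of Masson's "the beginning of the path is
  independent of the end up to constants" for LERW (Masson2009, Prop. 4.6 / Thm 4.7 separation lemma) and of
  the Garban–Pete–Schramm coupling lemma for percolation interfaces (GarbanPeteSchramm2013Pivotal §3,
  Prop. 11 / Lemma 13); for SAW nothing of the kind is in print (grounder note on the item, 2026-08-15).
* `stub_screenAbundance : ScreenAbundance` (L) — VERBATIM the sibling crux `CircleBridgeAbundance`
  (stmt-CriticalPhenomena-5462, rank 2): with law-probability `≥ c₀` some grid circle of radius in `[2ρ,3ρ]`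
  is crossed exactly once.  The route header records both directions of the dependency
  ("[deps: CircleBridgeAbundance]"; "implied by ScreenOverlap (diagonal case K = K′)" — the latter is
  `screenAbundance_of_screenOverlap'` below, proved), so S1 is an honest INPUT of any proof of S2 along this
  line and is discharged by whichever seat proves item 5462 (`screenAbundance_iff`).

PROVED glue (no `sorry`): `screenPartition` — for `0 < δ` the canonical screen data PARTITION the
single-crossing event, `Σ'_p P(E_p) = P(singleCrossing)` for every SAW law (`screenEvent_unique`: two data
charged by one walk coincide — the least index is unique, the crossing index is determined up to saturation
beyond `|γ|` by the `↔`-characterisation, hence so is the exit edge `(γ_k, γ_{k+1})`; `iUnion_screenEvent`: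
cover via `Nat.find`, using `0 ≤ δ` for the monotonicity of `j ↦ 2ρ + jδ`; then `measure_iUnion` on the
countable index type, every set being measurable for the `⊤` σ-algebra of `DomainSAW`).  Composition
`screenOverlap'_of`: with `c₁ := min c₂ 1 · c₀`, pointwise `min(P_p, P'_p) ≥ min(c₂,1) · P'_p` (Harnack in one
slot, `min c₂ 1 ≤ 1` in the other), sum (`ENNReal.tsum_le_tsum`, `ENNReal.tsum_mul_left`), rewrite by the
partition at `(K',a')`, bound below by abundance at `(K',a')` (its hypotheses are among the crux's); and
`ScreenOverlap_of : Registered.stub_exitHarnack → Registered.stub_screenAbundance → ScreenOverlap` concludes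
the route decl BY NAME.

## Disproof / negatives used
* `Cruxes/ScreenOverlap/Disproof.lean`: none exists (`ledger crux ls stmt-CriticalPhenomena-5463`: "no workfiles
  yet", 2026-08-17) — no `_false_without_` obstruction to honour, no landed `Theorems/ScreenOverlap/Negative/*`.
* `ledger negatives --problem CriticalPhenomena`: the only SAW-law negative is stmt-0772 (`IsTightLaws` over ALL
  `δ ∈ (0,1]`); not engaged — every statement here is at a FIXED mesh under explicit reachability hypotheses,
  with universal constants, exactly as the (refuter-checked, grounded) crux.
* Vacuity / junk pass: under the hypotheses both laws are honest probability laws (`Reachable` ⇒ a SAW exists ⇒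
  `weight univ > 0`; bounded `D` ⇒ finitely many SAWs ⇒ `weight univ < ∞`), so `ExitHarnack` is not met by the
  junk measure `0`; `ExitHarnack` forces `c₂ ≤ 1` (diagonal case) — harmless, it is existential; a datum `p`
  with `P_{K',a'}(E_p) = 0` makes its inequality trivial, and a datum charged by one law but not by the other
  (support defect) would refute it for every `c₂` — the cheapest falsifier (exact enumeration of inner prefixes
  at `ρ = 2δ, 3δ` in the flat half-disc for adversarial `K, K'`; the free band `ρ < |z−c| < 2ρ` is `K`-free and
  lattice-connected with room for the out–in–out re-crossing patterns, which is why no defect is expected).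
-/

noncomputable section

open scoped BigOperators Topology Classical ENNReal NNReal
open Filter Set MeasureTheory
open Literature.Probability.RandomPlanarGeometry Literature.Probability.LatticeModels

namespace Summit.CriticalPhenomena.SAWScalingLimit.Cruxes.ScreenOverlap.Birth

/-! ### 1. Vocabulary (verbatim from the crux and from `CircleBridgeAbundance`) -/

/-- The SINGLE-CROSSING event of `CircleBridgeAbundance` (S1): some grid circle `C(c, 2ρ + jδ)` with
`2ρ + jδ ≤ 3ρ` is crossed exactly once — the walk is inside the open ball up to some index `k` and outside
from `k+1` on.  VERBATIM the set of the route decl `CircleBridgeAbundance`. -/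
def singleCrossing (Ω : Set ℂ) (δ : ℝ) (a b : Site 2) (c : ℂ) (ρ : ℝ) : Set (SAW.DomainSAW Ω δ a b) :=
  {γ | ∃ j : ℕ, 2 * ρ + j * δ ≤ 3 * ρ ∧ ∃ k : ℕ, ∀ i ≤ γ.walk.length,
    dist (meshPoint δ (γ.walk.getVert i)) c < 2 * ρ + j * δ ↔ i ≤ k}

/-- The CANONICAL-SCREEN-DATUM event `E_p`, `p = (j, x, y)`: the grid circle `C(c, 2ρ + jδ)` (`≤ 3ρ`) is
crossed exactly once, at the exit edge `(x, y) = (γ_k, γ_{k+1})`, and NO smaller grid circle is crossed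
exactly once (`j` is the least such index).  VERBATIM the set of the route decl `ScreenOverlap`. -/
def screenEvent (Ω : Set ℂ) (δ : ℝ) (a b : Site 2) (c : ℂ) (ρ : ℝ) (p : ℕ × Site 2 × Site 2) :
    Set (SAW.DomainSAW Ω δ a b) :=
  {γ | 2 * ρ + p.1 * δ ≤ 3 * ρ ∧ (∃ k : ℕ, (∀ i ≤ γ.walk.length,
      dist (meshPoint δ (γ.walk.getVert i)) c < 2 * ρ + p.1 * δ ↔ i ≤ k) ∧
      γ.walk.getVert k = p.2.1 ∧ γ.walk.getVert (k + 1) = p.2.2) ∧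
    ∀ j < p.1, ¬ ∃ k : ℕ, ∀ i ≤ γ.walk.length,
      dist (meshPoint δ (γ.walk.getVert i)) c < 2 * ρ + j * δ ↔ i ≤ k}

/-- The OVERLAP MASS of the two canonical-screen-datum laws (the crux's right-hand side):
`Σ'_p min(P_{K,a}(E_p), P_{K',a'}(E_p))`, `P_{K,a} = SAW.law (D ∖ K)_δ a b`. -/
def screenOverlapMass (D : JordanDomain) (K K' : Set ℂ) (c : ℂ) (δ ρ : ℝ) (a a' b : Site 2) : ℝ≥0∞ :=
  ∑' p : ℕ × Site 2 × Site 2,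
    min (SAW.law (D.carrier \ K) δ a b (screenEvent (D.carrier \ K) δ a b c ρ p))
      (SAW.law (D.carrier \ K') δ a' b (screenEvent (D.carrier \ K') δ a' b c ρ p))

/-! ### 2. The stub statements -/

/-- STUB 1 statement — **exit Harnack (pointwise comparability of canonical-screen-datum laws across near
data)**: a universal `c₂ > 0` such that, under exactly the hypotheses of the crux (flat far geometry in
`B(c,4ρ)`, near data `(K,a)`, `(K',a')` inside `B̄(c,ρ)`, `2δ ≤ ρ`, common target `b` beyond `4ρ`, both
endpoint pairs joined), for EVERY datum `p`: `c₂ · P_{K',a'}(E_p) ≤ P_{K,a}(E_p)`. -/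
def ExitHarnack : Prop :=
  ∃ c₂ : ℝ, 0 < c₂ ∧ ∀ (D : JordanDomain) (K K' : Set ℂ) (c u : ℂ) (δ ρ : ℝ) (a a' b : Site 2),
    0 < δ → 2 * δ ≤ ρ → K ⊆ Metric.closedBall c ρ → K' ⊆ Metric.closedBall c ρ →
    D.carrier ∩ Metric.ball c (4 * ρ) = {z | u = 0 ∨ 0 < ((z - c) * u).im} ∩ Metric.ball c (4 * ρ) →
    dist (meshPoint δ a) c ≤ ρ → dist (meshPoint δ a') c ≤ ρ → 4 * ρ ≤ dist (meshPoint δ b) c →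
    (discreteDomainGraph (D.carrier \ K) δ).Reachable a b →
    (discreteDomainGraph (D.carrier \ K') δ).Reachable a' b →
    ∀ p : ℕ × Site 2 × Site 2,
      ENNReal.ofReal c₂ * SAW.law (D.carrier \ K') δ a' b (screenEvent (D.carrier \ K') δ a' b c ρ p) ≤
        SAW.law (D.carrier \ K) δ a b (screenEvent (D.carrier \ K) δ a b c ρ p)

/-- STUB 2 statement — **screen abundance** = the sibling crux `CircleBridgeAbundance` VERBATIM (S1): a
universal `c₀ > 0` bounding below the law-probability that some grid circle of radius in `[2ρ,3ρ]` is crossed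
exactly once, under the one-near-datum half of the crux's hypotheses. -/
def ScreenAbundance : Prop :=
  ∃ c₀ : ℝ, 0 < c₀ ∧ ∀ (D : JordanDomain) (K : Set ℂ) (c u : ℂ) (δ ρ : ℝ) (a b : Site 2),
    0 < δ → 2 * δ ≤ ρ → K ⊆ Metric.closedBall c ρ →
    D.carrier ∩ Metric.ball c (4 * ρ) = {z | u = 0 ∨ 0 < ((z - c) * u).im} ∩ Metric.ball c (4 * ρ) →
    dist (meshPoint δ a) c ≤ ρ → 4 * ρ ≤ dist (meshPoint δ b) c →
    (discreteDomainGraph (D.carrier \ K) δ).Reachable a b →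
    ENNReal.ofReal c₀ ≤ SAW.law (D.carrier \ K) δ a b (singleCrossing (D.carrier \ K) δ a b c ρ)

/-- `ScreenAbundance` IS the route decl `CircleBridgeAbundance` (item stmt-CriticalPhenomena-5462). -/
theorem screenAbundance_iff :
    ScreenAbundance ↔ Summit.CriticalPhenomena.SAWScalingLimit.Theses.SAWCircleScreening.CircleBridgeAbundance :=
  Iff.rfl

/-- The partition identity (PROVED below as `screenPartition`; kept as a named `Prop` so that the
composition and the diagonal sanity check can quote it): for `0 < δ` the canonical screen data partition
the single-crossing event, `Σ'_p P(E_p) = P(singleCrossing)` for every SAW law. -/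
def ScreenPartition : Prop :=
  ∀ (Ω : Set ℂ) (δ : ℝ) (a b : Site 2) (c : ℂ) (ρ : ℝ), 0 < δ →
    ∑' p : ℕ × Site 2 × Site 2, SAW.law Ω δ a b (screenEvent Ω δ a b c ρ p) =
      SAW.law Ω δ a b (singleCrossing Ω δ a b c ρ)

/-- The crux over the §1 vocabulary (definitionally the route decl, see `screenOverlap_iff`). -/
def ScreenOverlap' : Prop :=
  ∃ c₁ : ℝ, 0 < c₁ ∧ ∀ (D : JordanDomain) (K K' : Set ℂ) (c u : ℂ) (δ ρ : ℝ) (a a' b : Site 2),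
    0 < δ → 2 * δ ≤ ρ → K ⊆ Metric.closedBall c ρ → K' ⊆ Metric.closedBall c ρ →
    D.carrier ∩ Metric.ball c (4 * ρ) = {z | u = 0 ∨ 0 < ((z - c) * u).im} ∩ Metric.ball c (4 * ρ) →
    dist (meshPoint δ a) c ≤ ρ → dist (meshPoint δ a') c ≤ ρ → 4 * ρ ≤ dist (meshPoint δ b) c →
    (discreteDomainGraph (D.carrier \ K) δ).Reachable a b →
    (discreteDomainGraph (D.carrier \ K') δ).Reachable a' b →
    ENNReal.ofReal c₁ ≤ screenOverlapMass D K K' c δ ρ a a' b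

/-- The primed form IS the route decl: `ScreenOverlap` unfolds (delta on the §1 vocabulary) to
`ScreenOverlap'`. -/
theorem screenOverlap_iff :
    ScreenOverlap' ↔ Summit.CriticalPhenomena.SAWScalingLimit.Theses.SAWCircleScreening.ScreenOverlap :=
  Iff.rfl

/-! ### 3. The registered stubs (the only `sorry`s of the file) -/

/-- STUB 1 (XL, HARDEST): exit Harnack — pointwise comparability, uniform in the near data, of the laws of the
canonical screen datum under two critical SAW laws with the same flat far geometry and target. -/
theorem stub_exitHarnack : ExitHarnack := by
  sorry

/-- STUB 2 (L): screen abundance — verbatim `CircleBridgeAbundance` (item stmt-CriticalPhenomena-5462). -/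
theorem stub_screenAbundance : ScreenAbundance := by
  sorry

/-! ### Name-keyed aliases of the stub statements (hypotheses of the composition)

`Registered.stub_X : Prop` is the statement of `stub_X` under the registered stub's short name, so that the
skeleton audit (`#h21_check_skeleton`: hypotheses admissible iff registered stubs BY NAME) accepts
`ScreenOverlap_of : Registered.stub_… → … → ScreenOverlap` (device of `Cruxes/ChainLaw/Lines/birth.lean`,
`Cruxes/BoundaryMixing/Lines/birth.lean`). -/
namespace Registered

/-- Alias keyed by the registered stub name. -/
abbrev stub_exitHarnack : Prop := ExitHarnack
/-- Alias keyed by the registered stub name. -/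
abbrev stub_screenAbundance : Prop := ScreenAbundance

end Registered

/-! ### 4. Proved glue: the canonical screen data partition the single-crossing event -/

section Partition

variable {Ω : Set ℂ} {δ : ℝ} {a b : Site 2} {c : ℂ} {ρ : ℝ}

/-- Two canonical screen data charged by the same walk coincide: the least index is unique (minimality
clauses), the crossing index is determined up to saturation beyond the length (the `↔`-characterisation
at `i = k`, `k + 1`, `|γ|`), hence so is the exit edge (`getVert` saturates at the endpoint). -/
theorem screenEvent_unique {γ : SAW.DomainSAW Ω δ a b} {p q : ℕ × Site 2 × Site 2}
    (hp : γ ∈ screenEvent Ω δ a b c ρ p) (hq : γ ∈ screenEvent Ω δ a b c ρ q) : p = q := by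
  obtain ⟨j, x, y⟩ := p
  obtain ⟨j', x', y'⟩ := q
  simp only [screenEvent, Set.mem_setOf_eq] at hp hq
  obtain ⟨-, ⟨kp, hkp, hxp, hyp⟩, hminp⟩ := hp
  obtain ⟨-, ⟨kq, hkq, hxq, hyq⟩, hminq⟩ := hq
  -- the least indices agree
  have hj : j = j' := by
    by_contra hne
    rcases lt_or_gt_of_ne hne with hlt | hlt
    · exact hminq j hlt ⟨kp, hkp⟩
    · exact hminp j' hlt ⟨kq, hkq⟩
  subst hj
  -- the crossing indices agree up to saturation
  set n := γ.walk.length with hn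
  have hiff : ∀ i ≤ n, (i ≤ kp ↔ i ≤ kq) := fun i hi => (hkp i hi).symm.trans (hkq i hi)
  have hk : kp = kq ∨ (n ≤ kp ∧ n ≤ kq) := by
    rcases lt_or_ge kp n with hlt | hle
    · left
      have h1 : kp ≤ kq := (hiff kp hlt.le).1 le_rfl
      have h2 : ¬ (kp + 1 ≤ kq) := fun h => absurd ((hiff (kp + 1) hlt).2 h) (by omega)
      omega
    · exact Or.inr ⟨hle, (hiff n le_rfl).1 hle⟩
  have hx : γ.walk.getVert kp = γ.walk.getVert kq := by
    rcases hk with h | ⟨h1, h2⟩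
    · rw [h]
    · rw [γ.walk.getVert_of_length_le h1, γ.walk.getVert_of_length_le h2]
  have hy : γ.walk.getVert (kp + 1) = γ.walk.getVert (kq + 1) := by
    rcases hk with h | ⟨h1, h2⟩
    · rw [h]
    · rw [γ.walk.getVert_of_length_le (by omega), γ.walk.getVert_of_length_le (by omega)]
  have hxx : x = x' := hxp.symm.trans (hx.trans hxq)
  have hyy : y = y' := hyp.symm.trans (hy.trans hyq)
  subst hxx; subst hyy
  rfl

/-- The canonical-screen-datum events are pairwise disjoint. -/
theorem pairwise_disjoint_screenEvent (Ω : Set ℂ) (δ : ℝ) (a b : Site 2) (c : ℂ) (ρ : ℝ) :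
    Pairwise (Function.onFun Disjoint fun p : ℕ × Site 2 × Site 2 => screenEvent Ω δ a b c ρ p) := by
  intro p q hpq
  exact Set.disjoint_left.2 fun γ hp hq => hpq (screenEvent_unique hp hq)

/-- The canonical-screen-datum events cover the single-crossing event (and are contained in it): for
`0 ≤ δ` the LEAST index `j` with a single crossing (`Nat.find`) still has radius `≤ 3ρ`. -/
theorem iUnion_screenEvent (Ω : Set ℂ) (δ : ℝ) (a b : Site 2) (c : ℂ) (ρ : ℝ) (hδ : 0 ≤ δ) :
    (⋃ p : ℕ × Site 2 × Site 2, screenEvent Ω δ a b c ρ p) = singleCrossing Ω δ a b c ρ := by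
  ext γ
  simp only [Set.mem_iUnion, screenEvent, singleCrossing, Set.mem_setOf_eq]
  constructor
  · rintro ⟨p, hr, ⟨k, hk, -, -⟩, -⟩
    exact ⟨p.1, hr, k, hk⟩
  · rintro ⟨j, hj, k, hk⟩
    have hex : ∃ j' k' : ℕ, ∀ i ≤ γ.walk.length,
        dist (meshPoint δ (γ.walk.getVert i)) c < 2 * ρ + j' * δ ↔ i ≤ k' := ⟨j, k, hk⟩
    obtain ⟨k₀, hk₀⟩ := Nat.find_spec hex
    have hj₀ : Nat.find hex ≤ j := Nat.find_min' hex ⟨k, hk⟩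
    refine ⟨(Nat.find hex, γ.walk.getVert k₀, γ.walk.getVert (k₀ + 1)), ?_, ⟨k₀, hk₀, rfl, rfl⟩, ?_⟩
    · have hcast : ((Nat.find hex : ℕ) : ℝ) ≤ j := Nat.cast_le.2 hj₀
      have hmul : ((Nat.find hex : ℕ) : ℝ) * δ ≤ (j : ℝ) * δ := mul_le_mul_of_nonneg_right hcast hδ
      simpa using (by linarith : 2 * ρ + ((Nat.find hex : ℕ) : ℝ) * δ ≤ 3 * ρ)
    · intro j' hj' hex'
      exact Nat.find_min hex hj' hex'

/-- **Screen partition (PROVED)**: `Σ'_p P(E_p) = P(singleCrossing)` for `0 < δ` — σ-additivity of the SAW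
law over the pairwise-disjoint cover on the countable index type `ℕ × ℤ² × ℤ²` (every set is measurable:
the σ-algebra on `DomainSAW` is `⊤`). -/
theorem screenPartition : ScreenPartition := by
  intro Ω δ a b c ρ hδ
  rw [← iUnion_screenEvent Ω δ a b c ρ hδ.le,
    measure_iUnion (pairwise_disjoint_screenEvent Ω δ a b c ρ) fun _ => MeasurableSpace.measurableSet_top]

end Partition

/-! ### 5. The sorry-free composition -/

/-- Pointwise core: Harnack in one slot and `C ≤ 1` in the other give `C · P' ≤ min(P, P')`. -/
theorem min_mul_le_min {C H P P' : ℝ≥0∞} (hC1 : C ≤ 1) (hCH : C ≤ H) (hHar : H * P' ≤ P) :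
    C * P' ≤ min P P' := by
  refine le_min ?_ ?_
  · calc C * P' ≤ H * P' := by gcongr
      _ ≤ P := hHar
  · calc C * P' ≤ 1 * P' := by gcongr
      _ = P' := one_mul P'

/-- **The composition in the primed form** (no `sorry`): with `c₁ := min c₂ 1 · c₀`,
`Σ'_p min(P_p, P'_p) ≥ min(c₂,1) · Σ'_p P'_p = min(c₂,1) · P'(singleCrossing) ≥ min(c₂,1) · c₀`. -/
theorem screenOverlap'_of (hH : ExitHarnack) (hA : ScreenAbundance) : ScreenOverlap' := by
  obtain ⟨c₂, hc₂, H⟩ := hH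
  obtain ⟨c₀, hc₀, A⟩ := hA
  have hC0 : (0 : ℝ) ≤ min c₂ 1 := le_min hc₂.le zero_le_one
  refine ⟨min c₂ 1 * c₀, mul_pos (lt_min hc₂ one_pos) hc₀, ?_⟩
  intro D K K' c u δ ρ a a' b hδ hρ hK hK' hflat ha ha' hb hab ha'b
  have hC1 : ENNReal.ofReal (min c₂ 1) ≤ 1 := ENNReal.ofReal_le_one.2 (min_le_right _ _)
  have hCH : ENNReal.ofReal (min c₂ 1) ≤ ENNReal.ofReal c₂ := ENNReal.ofReal_le_ofReal (min_le_left _ _)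
  -- pointwise: min(c₂,1) · P'(E_p) ≤ min(P(E_p), P'(E_p))
  have key : ∀ p : ℕ × Site 2 × Site 2,
      ENNReal.ofReal (min c₂ 1) *
          SAW.law (D.carrier \ K') δ a' b (screenEvent (D.carrier \ K') δ a' b c ρ p) ≤
        min (SAW.law (D.carrier \ K) δ a b (screenEvent (D.carrier \ K) δ a b c ρ p))
          (SAW.law (D.carrier \ K') δ a' b (screenEvent (D.carrier \ K') δ a' b c ρ p)) :=
    fun p => min_mul_le_min hC1 hCH (H D K K' c u δ ρ a a' b hδ hρ hK hK' hflat ha ha' hb hab ha'b p)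
  -- sum over the screen data
  have hsum : ENNReal.ofReal (min c₂ 1) *
        ∑' p : ℕ × Site 2 × Site 2,
          SAW.law (D.carrier \ K') δ a' b (screenEvent (D.carrier \ K') δ a' b c ρ p) ≤
      screenOverlapMass D K K' c δ ρ a a' b := by
    rw [← ENNReal.tsum_mul_left]
    exact ENNReal.tsum_le_tsum key
  -- partition at (K', a') (proved) and abundance at (K', a') (stub 2)
  have hpart := screenPartition (D.carrier \ K') δ a' b c ρ hδ
  have habund := A D K' c u δ ρ a' b hδ hρ hK' hflat ha' hb ha'b
  calc ENNReal.ofReal (min c₂ 1 * c₀)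
        = ENNReal.ofReal (min c₂ 1) * ENNReal.ofReal c₀ := ENNReal.ofReal_mul hC0
    _ ≤ ENNReal.ofReal (min c₂ 1) *
          SAW.law (D.carrier \ K') δ a' b (singleCrossing (D.carrier \ K') δ a' b c ρ) := by
        gcongr
    _ = ENNReal.ofReal (min c₂ 1) *
          ∑' p : ℕ × Site 2 × Site 2,
            SAW.law (D.carrier \ K') δ a' b (screenEvent (D.carrier \ K') δ a' b c ρ p) := by
        rw [hpart]
    _ ≤ screenOverlapMass D K K' c δ ρ a a' b := hsum

/-- **The composition (kernel-checked, no `sorry`)**: the two stubs imply the crux `ScreenOverlap`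
BY NAME. -/
theorem ScreenOverlap_of (h1 : Registered.stub_exitHarnack) (h2 : Registered.stub_screenAbundance) :
    Summit.CriticalPhenomena.SAWScalingLimit.Theses.SAWCircleScreening.ScreenOverlap :=
  screenOverlap_iff.mp (screenOverlap'_of h1 h2)

/-- Wiring check: the registered stubs feed `ScreenOverlap_of` as stated. -/
example : Summit.CriticalPhenomena.SAWScalingLimit.Theses.SAWCircleScreening.ScreenOverlap :=
  ScreenOverlap_of stub_exitHarnack stub_screenAbundance

/-- Sanity (diagonal case, documented in the route header: "implied by ScreenOverlap (diagonal case
K = K′)"): the crux gives back screen abundance (= `CircleBridgeAbundance`) with the same constant, by the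
proved partition identity — so stub 2 is NECESSARY for the crux, not an artefact of the line. -/
theorem screenAbundance_of_screenOverlap' (h : ScreenOverlap') : ScreenAbundance := by
  obtain ⟨c₁, hc₁, O⟩ := h
  refine ⟨c₁, hc₁, ?_⟩
  intro D K c u δ ρ a b hδ hρ hK hflat ha hb hab
  have h1 := O D K K c u δ ρ a a b hδ hρ hK hK hflat ha ha hb hab hab
  rw [← screenPartition (D.carrier \ K) δ a b c ρ hδ]
  refine le_trans h1 ?_
  unfold screenOverlapMass
  exact ENNReal.tsum_le_tsum fun p => min_le_left _ _

end Summit.CriticalPhenomena.SAWScalingLimit.Cruxes.ScreenOverlap.Birth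

end
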